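import Mathlib.RingTheory.GradedAlgebra.HomogeneousLocalization
import Mathlib.RingTheory.MvPolynomial.Homogeneous
import Mathlib.Algebra.BigOperators.Fin
import HarnessLib

/-!
# [OURS · L1 W4.5(b) · EL♮(3) · NEST host kit, part 3a] Small print on homogeneous fractions `Away.mk` and the setting of `ℙ²_R`
# (charts `D₊(X₁)`, `D₊(X₂)`, overlap `D₊(X₁X₂)`) — helper file of `…NatPlaneCurveTwistedSplit`

Crux chain w45b (cell `res-hironaka`, LADDER-RESOLUTION rung L, slot W4.5(b)), child EL♮(3) = stmt-ResolutionOfSingularities-20148; WIDTH TABLE D3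
«NEST».  res-L1-w45b-iso-w2 g2 (WIDTH seat D-0157 DOOR 1), `--supports stmt-ResolutionOfSingularities-20148 --as helper`.  OURS plumbing; NOT a
statement of any manuscript; AI-written, weaker than expert review.  No `sorry`; standard axioms; DEF-FREE.

WHAT (namespace `…Cruxes.EquisingularLiftNat.Sections.PlaneCurveSplit`).
* GENERIC (any graded ring `𝒜`, any homogeneous `f`): `away_mk_eq_mk` (`a/fⁿ = a'/f^{n'}` from `a f^{n'} = a' fⁿ`, the two degree bookkeepings of
  `f` may differ), `away_mk_add`, `away_mk_mul`, `away_mk_pow`, `away_mk_zero`, `away_mk_neg` — Mathlib has `Away.mk`, `Away.val_mk`,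
  `Away.mk_surjective`, `awayMap_mk` but not these conveniences.
* `ℙ²_R = Proj R[X₀,X₁,X₂]` (grading `MvPolynomial.homogeneousSubmodule (Fin 3) R`): memberships `X_one_mem`, `X_two_mem`, `X_one_mul_X_two_mem`,
  `X_two_sq_mem` (numerator of the transition `X₂/X₁ = X₂²/(X₁X₂)`), `mul_X_two_pow_mem` (numerator of `F/X₁^d = F X₂^d/(X₁X₂)^d`), the monomial
  normal form `monomial_eq_C_mul_X_pow`, `support_degree_eq`, `isHomogeneous_C_mul_monomial`, `monomial_mem`.

References (index only): R. Hartshorne, *Algebraic Geometry* (1977), II §2 (Proj), III §5 [cite: Hartshorne1977].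
-/

set_option linter.dupNamespace false -- mandated namespace `Summit.<Summit>.<Problem>` of this single-conjunct summit

noncomputable section

open MvPolynomial HomogeneousLocalization

namespace Summit.ResolutionOfSingularities.ResolutionOfSingularities.Cruxes.EquisingularLiftNat.Sections

namespace PlaneCurveSplit

universe u

/-! ### Small print on `HomogeneousLocalization.Away.mk` -/

section AwayMk

variable {ι A σ : Type*} [CommRing A] [SetLike σ A] [AddSubgroupClass σ A] [AddCommMonoid ι] [DecidableEq ι]
  (𝒜 : ι → σ) [GradedRing 𝒜] {f : A} {i : ι} (hf : f ∈ 𝒜 i)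

/-- Two fractions `a / fⁿ`, `a' / f^{n'}` with `a · f^{n'} = a' · fⁿ` are equal (the degree bookkeeping of `f` may differ on the two
sides: `i` and `i'` are propositionally, not syntactically, equal in applications). [folklore] -/
theorem away_mk_eq_mk {i' : ι} (hf' : f ∈ 𝒜 i') {n n' : ℕ} {a a' : A} (ha : a ∈ 𝒜 (n • i)) (ha' : a' ∈ 𝒜 (n' • i'))
    (h : a * f ^ n' = a' * f ^ n) : Away.mk 𝒜 hf n a ha = Away.mk 𝒜 hf' n' a' ha' := by
  apply HomogeneousLocalization.val_injective
  rw [Away.val_mk, Away.val_mk, Localization.mk_eq_mk_iff, Localization.r_iff_exists]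
  exact ⟨1, by simp only [OneMemClass.coe_one, one_mul]; rw [mul_comm, h, mul_comm]⟩

/-- Sum of two fractions with the same denominator. [folklore] -/
theorem away_mk_add {n : ℕ} {a b : A} (ha : a ∈ 𝒜 (n • i)) (hb : b ∈ 𝒜 (n • i)) :
    Away.mk 𝒜 hf n a ha + Away.mk 𝒜 hf n b hb = Away.mk 𝒜 hf n (a + b) (add_mem ha hb) := by
  apply HomogeneousLocalization.val_injective
  rw [val_add, Away.val_mk, Away.val_mk, Away.val_mk, Localization.add_mk_self]

/-- Product of two fractions. [folklore] -/
theorem away_mk_mul {n n' : ℕ} {a a' : A} (ha : a ∈ 𝒜 (n • i)) (ha' : a' ∈ 𝒜 (n' • i)) :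
    Away.mk 𝒜 hf n a ha * Away.mk 𝒜 hf n' a' ha' =
      Away.mk 𝒜 hf (n + n') (a * a') (by rw [add_smul]; exact SetLike.mul_mem_graded ha ha') := by
  apply HomogeneousLocalization.val_injective
  rw [val_mul, Away.val_mk, Away.val_mk, Away.val_mk, Localization.mk_mul]
  congr 1
  exact Subtype.ext (pow_add f n n').symm

/-- Power of a fraction. [folklore] -/
theorem away_mk_pow {n : ℕ} {a : A} (ha : a ∈ 𝒜 (n • i)) (k : ℕ) :
    Away.mk 𝒜 hf n a ha ^ k = Away.mk 𝒜 hf (k * n) (a ^ k) (by rw [mul_smul]; exact SetLike.pow_mem_graded k ha) := by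
  apply HomogeneousLocalization.val_injective
  rw [val_pow, Away.val_mk, Away.val_mk, Localization.mk_pow]
  exact Localization.mk_eq_mk_iff.mpr (Localization.r_iff_exists.mpr
    ⟨1, by simp only [OneMemClass.coe_one, one_mul, SubmonoidClass.mk_pow, ← pow_mul, mul_comm k n]⟩)

/-- The zero fraction. [folklore] -/
theorem away_mk_zero (n : ℕ) : Away.mk 𝒜 hf n 0 (zero_mem _) = 0 := by
  apply HomogeneousLocalization.val_injective
  rw [Away.val_mk, val_zero, Localization.mk_zero]

/-- Negation of a fraction. [folklore] -/
theorem away_mk_neg {n : ℕ} {a : A} (ha : a ∈ 𝒜 (n • i)) :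
    -Away.mk 𝒜 hf n a ha = Away.mk 𝒜 hf n (-a) (neg_mem ha) := by
  apply HomogeneousLocalization.val_injective
  rw [val_neg, Away.val_mk, Away.val_mk, Localization.neg_mk]

end AwayMk

/-! ### The setting: `ℙ²_R = Proj R[X₀,X₁,X₂]`, charts `D₊(X₁)`, `D₊(X₂)`, overlap `D₊(X₁X₂)` -/

section Plane

variable (R : Type u) [CommRing R]

/-- `X₁` is homogeneous of degree `1`. [folklore] -/
theorem X_one_mem : (X 1 : MvPolynomial (Fin 3) R) ∈ homogeneousSubmodule (Fin 3) R 1 := isHomogeneous_X R 1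

/-- `X₂` is homogeneous of degree `1`. [folklore] -/
theorem X_two_mem : (X 2 : MvPolynomial (Fin 3) R) ∈ homogeneousSubmodule (Fin 3) R 1 := isHomogeneous_X R 2

/-- `X₁X₂` is homogeneous of degree `2`. [folklore] -/
theorem X_one_mul_X_two_mem : (X 1 * X 2 : MvPolynomial (Fin 3) R) ∈ homogeneousSubmodule (Fin 3) R 2 :=
  (isHomogeneous_X R 1).mul (isHomogeneous_X R 2)

/-- `(X₂)²` is homogeneous of degree `1 • 2` (numerator of the transition `T = X₂/X₁ = X₂²/(X₁X₂)`). [folklore] -/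
theorem X_two_sq_mem : (X 2 * X 2 : MvPolynomial (Fin 3) R) ∈ homogeneousSubmodule (Fin 3) R ((1 : ℕ) • 2) :=
  (isHomogeneous_X R 2).mul (isHomogeneous_X R 2)

variable {R}

/-- `F · X₂^d` is homogeneous of degree `d • 2` (numerator of `F/X₁^d = F X₂^d/(X₁X₂)^d`). [folklore] -/
theorem mul_X_two_pow_mem {d : ℕ} {F : MvPolynomial (Fin 3) R} (hF : F.IsHomogeneous d) :
    F * X 2 ^ d ∈ homogeneousSubmodule (Fin 3) R (d • 2) := by
  rw [mem_homogeneousSubmodule, smul_eq_mul, mul_two]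
  simpa using hF.mul ((isHomogeneous_X R (2 : Fin 3)).pow d)

/-- A monomial of `R[X₀,X₁,X₂]` in product form. [folklore] -/
theorem monomial_eq_C_mul_X_pow (s : Fin 3 →₀ ℕ) (r : R) :
    monomial s r = C r * X 0 ^ (s 0) * X 1 ^ (s 1) * X 2 ^ (s 2) := by
  rw [monomial_eq, Finsupp.prod_fintype _ _ (fun i => by simp), Fin.prod_univ_three]
  ring

/-- The exponents of a monomial in the support of a homogeneous polynomial add up to its degree. [folklore] -/
theorem support_degree_eq {G : MvPolynomial (Fin 3) R} {N : ℕ} (hG : G.IsHomogeneous N) (s : Fin 3 →₀ ℕ)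
    (hs : s ∈ G.support) : s 0 + s 1 + s 2 = N := by
  have h := hG (mem_support_iff.mp hs)
  rw [Finsupp.weight_apply, Finsupp.sum_fintype _ _ (fun i => by simp)] at h
  simpa [Fin.sum_univ_three] using h

/-- `C r · X₀ⁱ X₁ʲ X₂ˡ` is homogeneous of degree `i + j + l`. [folklore] -/
theorem isHomogeneous_C_mul_monomial (r : R) (i j l : ℕ) :
    (C r * X 0 ^ i * X 1 ^ j * X 2 ^ l : MvPolynomial (Fin 3) R).IsHomogeneous (i + j + l) := by
  have h := (((isHomogeneous_C (Fin 3) r).mul ((isHomogeneous_X R (0 : Fin 3)).pow i)).mul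
    ((isHomogeneous_X R (1 : Fin 3)).pow j)).mul ((isHomogeneous_X R (2 : Fin 3)).pow l)
  simpa using h

/-- The numerator membership of the monomial fraction `C r · X₀ⁱ X₁ʲ X₂ˡ / (X₁X₂)^m`, `i + j + l = 2m`. [folklore] -/
theorem monomial_mem {i j l m : ℕ} (h : i + j + l = 2 * m) (r : R) :
    (C r * X 0 ^ i * X 1 ^ j * X 2 ^ l : MvPolynomial (Fin 3) R) ∈ homogeneousSubmodule (Fin 3) R (m • 2) := by
  rw [mem_homogeneousSubmodule, smul_eq_mul, show m * 2 = i + j + l by omega]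
  exact isHomogeneous_C_mul_monomial r i j l

end Plane

end PlaneCurveSplit

end Summit.ResolutionOfSingularities.ResolutionOfSingularities.Cruxes.EquisingularLiftNat.Sections

end
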